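import Summits.QuantumFields.YangMills.Theses.CheckerboardTriality
import HarnessLib

/-!
# Route `CheckerboardTriality`: the glue item `TrialityLimitOfCells` (stmt-QuantumFields-22669)

`TrialityOnCheckerboardCells → CheckerboardCoverTransfer → CheckerboardCellsExist → TrialityLimit`, pure limits
algebra over the tree (LINE g8-B of planner ym-idea-1 g8, «CheckerboardCells»: restrict-then-tighten on the TORUS SHAPE):

* `CheckerboardCellsExist` (C0) chooses, for every admissible leg scheme `sch`, the checkerboard double covers
  `C k : Theorems.ROT.PeriodCell 4` with period lattice `(2L_k+1)·D₄` and transversal `⊇ box 4 L_k`;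
* `TrialityOnCheckerboardCells` (C1) gives a radius `r₀ > 0` and, for every `F` in King's class `KingClass n r₀` and every
  `D₄`-preserving linear isometry `R`, `dist_{C_k}(R·F) − dist_{C_k}(F) → 0`;
* `CheckerboardCoverTransfer` (C2) gives `dist_{C_k}(F) − latticeDist_k(F) → 0` for every off-diagonal compactly supported `F`
  — applied to `F` and to `R·F` (King's class is stable under linear isometries, `King.linActMulti_mem_kingClass`);
* along any subsequence `φ → ∞` with an off-diagonal limit `S₁` (`OffDiagLimitAlong`), `latticeDist_{φ j}(F) → S₁ n F` and
  `latticeDist_{φ j}(R·F) → S₁ n (R·F)`, so `S₁ n (R·F) = S₁ n F` by uniqueness of limits (`tendsto_nhds_unique`).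

Width seat ym-t4-w17 g0 (cell ym-fleet, FILL-TO-CAP «width 17») for planner-of-record ym-idea-1 g8, per the director-desk
STAFFING NOTE 2026-08-28T16:23:33Z.  The cruxes `TrialityOnCheckerboardCells` (stmt-QuantumFields-22666) and
`CheckerboardCoverTransfer` (stmt-QuantumFields-22667) remain OPEN; no summit, leg, crux or rung statement is proved here
(R2d is a RECORD rung; the YM mass gap is NOT proved by any of this).
-/

set_option autoImplicit false

namespace Summit.QuantumFields.YangMills.Theorems

open Filter Topology
open Summit.QuantumFields.YangMills.Theses.CheckerboardTriality
  (TrialityLimit TrialityOnCheckerboardCells CheckerboardCoverTransfer CheckerboardCellsExist)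
open Summit.QuantumFields.YangMills.Cruxes.OSLegsAtWeakCouplingC.Y2Bridge (King.linActMulti_mem_kingClass)

/-- **Glue of LINE «CheckerboardCells»**: triality on the checkerboard double covers (C1), the cover-to-torus transfer (C2)
and the existence of the cells (C0) give `TrialityLimit` — choose the cells along the scheme, transfer both `F` and `R·F`
to the straight tori, and conclude by uniqueness of limits along the subsequence. [folklore] -/
theorem checkerboardTriality_trialityLimit_of_cells (h₁ : TrialityOnCheckerboardCells)
    (h₂ : CheckerboardCoverTransfer) (h₀ : CheckerboardCellsExist) : TrialityLimit := by
  unfold Summit.QuantumFields.YangMills.Theses.CheckerboardTriality.TrialityLimit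
  unfold Summit.QuantumFields.YangMills.Theses.CheckerboardTriality.TrialityOnCheckerboardCells at h₁
  unfold Summit.QuantumFields.YangMills.Theses.CheckerboardTriality.CheckerboardCoverTransfer at h₂
  unfold Summit.QuantumFields.YangMills.Theses.CheckerboardTriality.CheckerboardCellsExist at h₀
  intro G _ _ _ _ hG
  letI : MeasurableSpace G := borel G
  haveI : BorelSpace G := ⟨rfl⟩
  intro r a ha ha0 hMB sch hsch
  -- C0: the checkerboard double covers of the scheme's tori
  choose C hC using fun k => h₀ (sch.L k)
  -- C1: asymptotic `Aut(D₄)`-invariance on the cells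
  obtain ⟨r₀, hr₀, H₁⟩ := h₁ G hG r a ha ha0 hMB sch hsch C hC
  -- C2: cover-to-torus transfer
  have H₂ := h₂ G hG r a ha ha0 hMB sch hsch C hC
  refine ⟨r₀, hr₀, fun φ hφ S₁ hS₁ n hn F hF R hR => ?_⟩
  have hRF := King.linActMulti_mem_kingClass hF R
  -- the four limits along `φ`
  have limF := hS₁.2.2 n hn F hF.1
  have limRF := hS₁.2.2 n hn _ hRF.1
  have d₁ := (H₁ n hn F hF R hR).comp hφ
  have d₂ := (H₂ n hn F hF.1 hF.2.1).comp hφ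
  have d₃ := (H₂ n hn _ hRF.1 hRF.2.1).comp hφ
  -- `latticeDist(R·F) = −(dist_C(R·F) − latticeDist(R·F)) + (dist_C(R·F) − dist_C(F)) + (dist_C(F) − latticeDist(F)) + latticeDist(F)`
  have key := tendsto_nhds_unique limRF ((((d₃.neg.add d₁).add d₂).add limF).congr fun j => by
    simp only [Function.comp_apply]; ring)
  simpa using key

/-- **Item stmt-QuantumFields-22669 `CheckerboardTriality.TrialityLimitOfCells` holds**:
`TrialityOnCheckerboardCells → CheckerboardCoverTransfer → CheckerboardCellsExist → TrialityLimit`. [folklore] -/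
theorem checkerboardTriality_trialityLimitOfCells_proof :
    Summit.QuantumFields.YangMills.Theses.CheckerboardTriality.TrialityLimitOfCells :=
  fun h₁ h₂ h₀ => checkerboardTriality_trialityLimit_of_cells h₁ h₂ h₀

end Summit.QuantumFields.YangMills.Theorems
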